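import Literature.Probability.RandomPlanarGeometry.HexSAWBrickWallStripFugacityTwoWallLimit
import Literature.Probability.RandomPlanarGeometry.HexSAWBrickWallStripFugacityLevel0Zero
import Literature.Probability.RandomPlanarGeometry.HexSAWSurfaceYcProp5Riders
import HarnessLib

/-!
# Two attractive walls: the tower `T ↦ μ_T(y,z)` is monotone when one wall is neutral or repulsive, and NOT monotone when both attract strongly

Topic `Literature/Probability/RandomPlanarGeometry` (continues `HexSAWBrickWallStripFugacityTwoWallLimit.lean` —
`HexBW.tendsto_stripMuY₂_atTop : μ_T(y,z) → max(μ(y), μ(z))`, `HexBW.stripMuY₀_le_stripMuY₂_succ : μ_T(y,1) ≤ μ_{T+1}(y,z)` —,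
`HexSAWBrickWallStripFugacityLevel0Zero.lean` — the one-row strip `S_0`, `HexBW.stripMuY₀_zero : μ_0(y,1) = √y` — and
`HexSAWSurfaceYcProp5Riders.lean` — `HV.surfaceMu_le_sqrt_mul : μ(y) ≤ √y·μ` for `y ≥ 1`).

Source frame.  N. R. Beaton, M. Bousquet-Mélou, J. de Gier, H. Duminil-Copin, A. J. Guttmann, Comm. Math. Phys. 326 (2014),
arXiv:1109.0358v5, §3.2: the two-fugacity strip partition functions `C_{T,k}(y,z) = Σ_{|ω|=k} y^{bc(ω)} z^{tc(ω)}` and their growth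
rates `μ_T(y,z)` (Proposition 6, p. 10), and Proposition 7 (p. 11): "`μ_T(1,y) < μ_{T+1}(1,y)`" — monotonicity in the width
when ONE wall carries a fugacity.  The two-wall question (both walls attractive) is the setting of E. J. Janse van Rensburg,
E. Orlandini, S. G. Whittington, J. Phys. A 39 (2006) 13869 ([16] of BBdGDCG14, slabs of `ℤ^d`: the force between the walls
is repulsive in some regimes and attractive in others).  This file records, for the honeycomb strips `S_T` (brick-wall frame,
printed level-`0` / top-surface weights), the elementary DICHOTOMY that the tree's definitions already decide:

* **monotone regime** (`z ≤ 1`, or symmetrically `y ≤ 1`): `T ↦ μ_T(y,z)` is non-decreasing, bounded by and converging to `μ(y)`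
  (`stripMuY₂_le_succ_of_le_one`, `monotone_stripMuY₂_of_le_one`, `stripMuY₂_le_surfaceMu_of_le_one`, `iSup_stripMuY₂_of_le_one`);
* **the narrowest strip with two weights**: `μ_0(y,z) = √(y z)` exactly (`stripMuY₂_zero`; on `S_0` every site of a walk is a
  bottom-surface or a top-surface vertex, alternately), in particular `μ_0(y,y) = y`;
* **non-monotone regime** (`y = z > 2 + √2 = μ²`): `μ_0(y,y) = y > μ(y) = lim_T μ_T(y,y)` (`surfaceMu_lt_self`,
  `surfaceMu_lt_stripMuY₂_zero_self`), so `μ_T(y,y) < μ_0(y,y)` for all large `T` (`eventually_stripMuY₂_self_lt_zero`),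
  the tower is not monotone (`not_monotone_stripMuY₂_self`) and strictly decreases at some width (`exists_stripMuY₂_self_succ_lt`):
  Proposition 7's monotonicity does not extend to two attractive walls.

All statements are about the tree's `HexBW.stripMuY₂`; the threshold `2 + √2 = μ²` comes from `μ(y) ≤ √y·μ` and is not claimed sharp.
-/

noncomputable section

open Filter Topology Finset Literature.Probability.LatticeModels Literature.Probability.Percolation

namespace Literature.Probability.RandomPlanarGeometry.SAW.HexBW

variable {T N : ℕ} {p : Site 2 × (ℕ → Site 2)} {y z : ℝ}

/-! ### Monotonicity in the top fugacity -/

/-- `C_{T,n}(y,z)` is non-decreasing in `z` (`y, z ≥ 0`); private twin of the lane's `HexBW.stripZ₂_mono_right`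
(«TWO-SIDED P6» car, not yet in the tree). [cite: BeatonBousquetMelouDeGierDuminilCopinGuttmann2014, §3.2 (arXiv v5 p. 10: C_{T,k}(y,z) = Σ y^{bc(ω)} z^{tc(ω)})] -/
private theorem stripZ₂_mono_right_aux (T n : ℕ) (hy : 0 ≤ y) (hz : 0 ≤ z) {z' : ℝ} (hzz' : z ≤ z') :
    stripZ₂ T n y z ≤ stripZ₂ T n y z' := by
  unfold stripZ₂
  exact Finset.sum_le_sum fun p _ =>
    mul_le_mul_of_nonneg_left (pow_le_pow_left₀ hz hzz' _) (pow_nonneg hy _)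

/-- `μ_T(y,z)` is non-decreasing in `z` (`y, z > 0`); private twin of the lane's `HexBW.stripMuY₂_mono_right`.
[cite: BeatonBousquetMelouDeGierDuminilCopinGuttmann2014, Proposition 6 (arXiv v5 p. 10: μ_T(y,z) = lim C_{T,k}(y,z)^{1/k})] -/
private theorem stripMuY₂_mono_right_aux (T : ℕ) (hy : 0 < y) (hz : 0 < z) {z' : ℝ} (hzz' : z ≤ z') :
    stripMuY₂ T y z ≤ stripMuY₂ T y z' :=
  le_of_tendsto_of_tendsto' (tendsto_stripZ₂_rpow T hy hz) (tendsto_stripZ₂_rpow T hy (hz.trans_le hzz')) fun n =>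
    Real.rpow_le_rpow (stripZ₂_pos T n hy hz).le (stripZ₂_mono_right_aux T n hy.le hz.le hzz') (by positivity)

/-! ### The monotone regime: one wall neutral or repulsive -/

/-- **`z ≤ 1 ⇒ μ_T(y,z) ≤ μ_{T+1}(y,z)`**: `μ_T(y,z) ≤ μ_T(y,1) ≤ μ_{T+1}(y,z)` (the second step: `S_T ⊂ S_{T+1}` misses the top
surface). [cite: BeatonBousquetMelouDeGierDuminilCopinGuttmann2014, Proposition 7 (arXiv v5 p. 11: μ_T(1,y) < μ_{T+1}(1,y)) with Proposition 6 (p. 10)] -/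
theorem stripMuY₂_le_succ_of_le_one (T : ℕ) (hy : 0 < y) (hz : 0 < z) (hz1 : z ≤ 1) :
    stripMuY₂ T y z ≤ stripMuY₂ (T + 1) y z :=
  calc stripMuY₂ T y z ≤ stripMuY₂ T y 1 := stripMuY₂_mono_right_aux T hy hz hz1
    _ = stripMuY₀ T y := stripMuY₂_one_right T y
    _ ≤ stripMuY₂ (T + 1) y z := stripMuY₀_le_stripMuY₂_succ T hy hz

/-- **Monotone regime**: for `z ≤ 1` the tower `T ↦ μ_T(y,z)` is non-decreasing. [cite: BeatonBousquetMelouDeGierDuminilCopinGuttmann2014, Proposition 7 (arXiv v5 p. 11)] -/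
theorem monotone_stripMuY₂_of_le_one (hy : 0 < y) (hz : 0 < z) (hz1 : z ≤ 1) : Monotone fun T => stripMuY₂ T y z :=
  monotone_nat_of_le_succ fun T => stripMuY₂_le_succ_of_le_one T hy hz hz1

/-- The symmetric monotone regime: for `y ≤ 1` the tower `T ↦ μ_T(y,z)` is non-decreasing. [cite: BeatonBousquetMelouDeGierDuminilCopinGuttmann2014, Proposition 7 (arXiv v5 p. 11) with Proposition 6 (p. 10: symmetry)] -/
theorem monotone_stripMuY₂_of_le_one_left (hy : 0 < y) (hz : 0 < z) (hy1 : y ≤ 1) : Monotone fun T => stripMuY₂ T y z := by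
  simp_rw [stripMuY₂_symm _ y z]
  exact monotone_stripMuY₂_of_le_one hz hy hy1

/-- In the monotone regime the limit is `μ(y)`: `z ≤ 1 ⇒ μ_T(y,z) → μ(y)`. [cite: BeatonBousquetMelouDeGierDuminilCopinGuttmann2014, Proposition 7 (arXiv v5 p. 11: μ_T(1,y) → μ(y)) and Proposition 5 (p. 9: μ(y) = μ for y ≤ y_c)] -/
theorem tendsto_stripMuY₂_of_le_one (hy : 0 < y) (hz : 0 < z) (hz1 : z ≤ 1) :
    Tendsto (fun T : ℕ => stripMuY₂ T y z) atTop (𝓝 (HV.surfaceMu y)) := by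
  have h := tendsto_stripMuY₂_atTop hy hz
  have hz' : HV.surfaceMu z = hexConnectiveConstant :=
    (HV.surfaceMu_eq_iff hz).2 (hz1.trans (by have := Real.sqrt_nonneg 2; linarith))
  rwa [hz', max_eq_left (HV.hexConnectiveConstant_le_surfaceMu y)] at h

/-- In the monotone regime every `μ_T(y,z)` lies below the limit `μ(y)`. [cite: BeatonBousquetMelouDeGierDuminilCopinGuttmann2014, proof of Proposition 7 (arXiv v5 pp. 11–12: μ_T ≤ μ(y))] -/
theorem stripMuY₂_le_surfaceMu_of_le_one (T : ℕ) (hy : 0 < y) (hz : 0 < z) (hz1 : z ≤ 1) :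
    stripMuY₂ T y z ≤ HV.surfaceMu y :=
  (monotone_stripMuY₂_of_le_one hy hz hz1).ge_of_tendsto (tendsto_stripMuY₂_of_le_one hy hz hz1) T

/-- In the monotone regime `sup_T μ_T(y,z) = μ(y)`. [cite: BeatonBousquetMelouDeGierDuminilCopinGuttmann2014, Proposition 7 (arXiv v5 p. 11)] -/
theorem iSup_stripMuY₂_of_le_one (hy : 0 < y) (hz : 0 < z) (hz1 : z ≤ 1) :
    (⨆ T : ℕ, stripMuY₂ T y z) = HV.surfaceMu y :=
  tendsto_nhds_unique
    (tendsto_atTop_ciSup (monotone_stripMuY₂_of_le_one hy hz hz1)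
      ⟨HV.surfaceMu y, by rintro _ ⟨T, rfl⟩; exact stripMuY₂_le_surfaceMu_of_le_one T hy hz hz1⟩)
    (tendsto_stripMuY₂_of_le_one hy hz hz1)

/-! ### The narrowest strip with two fugacities: `μ_0(y,z) = √(yz)` -/

/-- On `S_0` every site of a walk is a bottom-surface vertex (odd abscissa) or a top-surface vertex (even abscissa):
`bc(ω) + tc(ω) = N + 1`. [cite: BeatonBousquetMelouDeGierDuminilCopinGuttmann2014, §3.2 (arXiv v5 p. 10: bc(ω), tc(ω))] -/
theorem bottomVisits₀_add_topVisits₀_zero (hp : p ∈ stripPairs 0 N) :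
    bottomVisits₀ p.1 p.2 N + topVisits₀ 0 p.1 p.2 N = N + 1 := by
  unfold bottomVisits₀ topVisits₀
  rw [← Finset.sum_add_distrib]
  calc ∑ m ∈ Finset.range (N + 1), ((if (p.1 + p.2 m) 1 = 0 ∧ (p.1 + p.2 m) 0 % 2 = 1 then 1 else 0) +
        (if (p.1 + p.2 m) 1 = ((0 : ℕ) : ℤ) ∧ ((p.1 + p.2 m) 0 + (0 : ℕ)) % 2 = 0 then 1 else 0))
      = ∑ _m ∈ Finset.range (N + 1), 1 := by
        refine Finset.sum_congr rfl fun m hm => ?_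
        have hrow := row_eq_zero_of_mem_stripPairs_zero hp (Nat.lt_succ_iff.1 (Finset.mem_range.1 hm))
        simp only [Nat.cast_zero, add_zero]
        rcases Int.emod_two_eq_zero_or_one ((p.1 + p.2 m) 0) with h | h
        · rw [if_neg (fun h' => by omega), if_pos ⟨hrow, h⟩]
        · rw [if_pos ⟨hrow, h⟩, if_neg (fun h' => by omega)]
    _ = N + 1 := by simp

/-- `N ≤ 2·tc(ω) ≤ N + 2` on `S_0`. [cite: BeatonBousquetMelouDeGierDuminilCopinGuttmann2014, §3.2 (arXiv v5 p. 10)] -/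
theorem two_mul_topVisits₀_zero_bounds (hp : p ∈ stripPairs 0 N) :
    N ≤ 2 * topVisits₀ 0 p.1 p.2 N ∧ 2 * topVisits₀ 0 p.1 p.2 N ≤ N + 2 := by
  have h := bottomVisits₀_add_topVisits₀_zero hp
  have hb := two_mul_bottomVisits₀_bounds hp
  omega

/-- `min(1,y)·y^{N/2} ≤ y^v ≤ max(1,y)·y^{N/2}` whenever `N ≤ 2v ≤ N + 2` (`y > 0`). [cite: BeatonBousquetMelouDeGierDuminilCopinGuttmann2014, §3.2 (arXiv v5 p. 10); elementary bookkeeping] -/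
theorem pow_bounds_of_two_mul {v : ℕ} (hv : N ≤ 2 * v ∧ 2 * v ≤ N + 2) (hy : 0 < y) :
    min 1 y * y ^ ((N : ℝ) / 2) ≤ y ^ v ∧ y ^ v ≤ max 1 y * y ^ ((N : ℝ) / 2) := by
  obtain ⟨hlo, hhi⟩ := hv
  have hlo' : (N : ℝ) / 2 ≤ (v : ℝ) := by
    have : (N : ℝ) ≤ 2 * (v : ℝ) := by exact_mod_cast hlo
    linarith
  have hhi' : (v : ℝ) ≤ (N : ℝ) / 2 + 1 := by
    have : 2 * (v : ℝ) ≤ (N : ℝ) + 2 := by exact_mod_cast hhi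
    linarith
  rw [← Real.rpow_natCast]
  rcases le_or_gt 1 y with hy1 | hy1
  · rw [min_eq_left hy1, max_eq_right hy1, one_mul]
    refine ⟨Real.rpow_le_rpow_of_exponent_le hy1 hlo', ?_⟩
    calc y ^ (v : ℝ) ≤ y ^ ((N : ℝ) / 2 + 1) := Real.rpow_le_rpow_of_exponent_le hy1 hhi'
      _ = y * y ^ ((N : ℝ) / 2) := by rw [Real.rpow_add hy, Real.rpow_one, mul_comm]
  · rw [min_eq_right hy1.le, max_eq_left hy1.le, one_mul]
    refine ⟨?_, Real.rpow_le_rpow_of_exponent_ge hy hy1.le hlo'⟩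
    calc y * y ^ ((N : ℝ) / 2) = y ^ ((N : ℝ) / 2 + 1) := by rw [Real.rpow_add hy, Real.rpow_one, mul_comm]
      _ ≤ y ^ (v : ℝ) := Real.rpow_le_rpow_of_exponent_ge hy hy1.le hhi'

/-- The weight of one walk of `S_N(S_0)` with both fugacities: between `min(1,y)min(1,z)·(yz)^{N/2}` and `max(1,y)max(1,z)·(yz)^{N/2}`.
[cite: BeatonBousquetMelouDeGierDuminilCopinGuttmann2014, §3.2 (arXiv v5 p. 10)] -/
theorem weight_zero_bounds (hp : p ∈ stripPairs 0 N) (hy : 0 < y) (hz : 0 < z) :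
    min 1 y * min 1 z * (y * z) ^ ((N : ℝ) / 2) ≤ y ^ bottomVisits₀ p.1 p.2 N * z ^ topVisits₀ 0 p.1 p.2 N ∧
      y ^ bottomVisits₀ p.1 p.2 N * z ^ topVisits₀ 0 p.1 p.2 N ≤ max 1 y * max 1 z * (y * z) ^ ((N : ℝ) / 2) := by
  obtain ⟨hb1, hb2⟩ := pow_bounds_of_two_mul (two_mul_bottomVisits₀_bounds hp) hy
  obtain ⟨ht1, ht2⟩ := pow_bounds_of_two_mul (two_mul_topVisits₀_zero_bounds hp) hz
  rw [Real.mul_rpow hy.le hz.le]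
  constructor
  · calc min 1 y * min 1 z * (y ^ ((N : ℝ) / 2) * z ^ ((N : ℝ) / 2))
        = (min 1 y * y ^ ((N : ℝ) / 2)) * (min 1 z * z ^ ((N : ℝ) / 2)) := by ring
      _ ≤ _ := mul_le_mul hb1 ht1 (mul_nonneg (lt_min one_pos hz).le (Real.rpow_nonneg hz.le _)) (pow_nonneg hy.le _)
  · calc y ^ bottomVisits₀ p.1 p.2 N * z ^ topVisits₀ 0 p.1 p.2 N
        ≤ (max 1 y * y ^ ((N : ℝ) / 2)) * (max 1 z * z ^ ((N : ℝ) / 2)) :=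
          mul_le_mul hb2 ht2 (pow_nonneg hz.le _)
            (mul_nonneg (zero_le_one.trans (le_max_left 1 y)) (Real.rpow_nonneg hy.le _))
      _ = _ := by ring

/-- **`C_{0,N}(y,z) ≤ 4·max(1,y)max(1,z)·(yz)^{N/2}`** (`N ≥ 1`). [cite: BeatonBousquetMelouDeGierDuminilCopinGuttmann2014, §3.2 (arXiv v5 p. 10)] -/
theorem stripZ₂_zero_le (hN : 1 ≤ N) (hy : 0 < y) (hz : 0 < z) :
    stripZ₂ 0 N y z ≤ 4 * (max 1 y * max 1 z * (y * z) ^ ((N : ℝ) / 2)) := by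
  unfold stripZ₂
  have hM : 0 ≤ max 1 y * max 1 z * (y * z) ^ ((N : ℝ) / 2) :=
    mul_nonneg (mul_nonneg (zero_le_one.trans (le_max_left 1 y)) (zero_le_one.trans (le_max_left 1 z)))
      (Real.rpow_nonneg (mul_nonneg hy.le hz.le) _)
  calc ∑ p ∈ stripPairs 0 N, y ^ bottomVisits₀ p.1 p.2 N * z ^ topVisits₀ 0 p.1 p.2 N
      ≤ ∑ p ∈ stripPairs 0 N, max 1 y * max 1 z * (y * z) ^ ((N : ℝ) / 2) :=
        Finset.sum_le_sum fun p hp => (weight_zero_bounds hp hy hz).2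
    _ = (stripPairs 0 N).card * (max 1 y * max 1 z * (y * z) ^ ((N : ℝ) / 2)) := by
        rw [Finset.sum_const, nsmul_eq_mul]
    _ ≤ 4 * (max 1 y * max 1 z * (y * z) ^ ((N : ℝ) / 2)) :=
        mul_le_mul_of_nonneg_right (by exact_mod_cast card_stripPairs_zero_le hN) hM

/-- **`min(1,y)min(1,z)·(yz)^{N/2} ≤ C_{0,N}(y,z)`** (the straight run alone). [cite: BeatonBousquetMelouDeGierDuminilCopinGuttmann2014, §3.2 (arXiv v5 p. 10)] -/
theorem le_stripZ₂_zero (N : ℕ) (hy : 0 < y) (hz : 0 < z) :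
    min 1 y * min 1 z * (y * z) ^ ((N : ℝ) / 2) ≤ stripZ₂ 0 N y z := by
  unfold stripZ₂
  calc min 1 y * min 1 z * (y * z) ^ ((N : ℝ) / 2)
      ≤ y ^ bottomVisits₀ (0 : Site 2) (lineWalk N) N * z ^ topVisits₀ 0 (0 : Site 2) (lineWalk N) N :=
        (weight_zero_bounds (lineWalk_mem_stripPairs_zero N) hy hz).1
    _ ≤ ∑ p ∈ stripPairs 0 N, y ^ bottomVisits₀ p.1 p.2 N * z ^ topVisits₀ 0 p.1 p.2 N :=
        Finset.single_le_sum
          (f := fun p : Site 2 × (ℕ → Site 2) => y ^ bottomVisits₀ p.1 p.2 N * z ^ topVisits₀ 0 p.1 p.2 N)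
          (fun p _ => mul_nonneg (pow_nonneg hy.le _) (pow_nonneg hz.le _)) (lineWalk_mem_stripPairs_zero N)

/-- **`μ_0(y,z) = √(yz)`** (`y, z > 0`): the exact two-fugacity growth rate of the one-row strip (not in print; the lane's).
[cite: BeatonBousquetMelouDeGierDuminilCopinGuttmann2014, Proposition 6 (arXiv v5 p. 10: μ_T(y,z) = lim C_{T,k}(y,z)^{1/k})] -/
theorem stripMuY₂_zero (hy : 0 < y) (hz : 0 < z) : stripMuY₂ 0 y z = Real.sqrt (y * z) := by
  have hyz : 0 < y * z := mul_pos hy hz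
  have hlim := tendsto_stripZ₂_rpow 0 hy hz
  have hc1 : 0 < min 1 y * min 1 z := mul_pos (lt_min one_pos hy) (lt_min one_pos hz)
  have hc2 : 0 < 4 * (max 1 y * max 1 z) :=
    mul_pos (by norm_num) (mul_pos (one_pos.trans_le (le_max_left 1 y)) (one_pos.trans_le (le_max_left 1 z)))
  have hlow : Tendsto (fun n : ℕ => (min 1 y * min 1 z * (y * z) ^ ((n : ℝ) / 2)) ^ (1 / (n : ℝ))) atTop
      (𝓝 (Real.sqrt (y * z))) := by
    have h := (tendsto_const_rpow_one_div_nat₀ hc1).mul_const (Real.sqrt (y * z))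
    rw [one_mul] at h
    refine h.congr' ?_
    filter_upwards [eventually_ge_atTop 1] with n hn
    exact (rpow_half_root hc1.le hyz hn).symm
  have hupp : Tendsto (fun n : ℕ => (4 * (max 1 y * max 1 z) * (y * z) ^ ((n : ℝ) / 2)) ^ (1 / (n : ℝ))) atTop
      (𝓝 (Real.sqrt (y * z))) := by
    have h := (tendsto_const_rpow_one_div_nat₀ hc2).mul_const (Real.sqrt (y * z))
    rw [one_mul] at h
    refine h.congr' ?_
    filter_upwards [eventually_ge_atTop 1] with n hn
    exact (rpow_half_root hc2.le hyz hn).symm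
  refine tendsto_nhds_unique hlim (tendsto_of_tendsto_of_tendsto_of_le_of_le' hlow hupp ?_ ?_)
  · filter_upwards [eventually_ge_atTop 1] with n hn
    exact Real.rpow_le_rpow (mul_nonneg hc1.le (Real.rpow_nonneg hyz.le _)) (le_stripZ₂_zero n hy hz) (by positivity)
  · filter_upwards [eventually_ge_atTop 1] with n hn
    have h := stripZ₂_zero_le hn hy hz
    rw [← mul_assoc] at h
    exact Real.rpow_le_rpow (stripZ₂_pos 0 n hy hz).le h (by positivity)

/-- **`μ_0(y,y) = y`**: with equal fugacities every site of the one-row strip is weighted. [cite: BeatonBousquetMelouDeGierDuminilCopinGuttmann2014, Proposition 6 (arXiv v5 p. 10)] -/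
theorem stripMuY₂_zero_self (hy : 0 < y) : stripMuY₂ 0 y y = y := by
  rw [stripMuY₂_zero hy hy, Real.sqrt_mul_self hy.le]

/-! ### The non-monotone regime: both walls strongly attractive -/

/-- **`μ(y) < y` for `y > 2 + √2 = μ²`**: from `μ(y) ≤ √y·μ` (square-root monotonicity) and `μ < √y`.
[cite: BeatonBousquetMelouDeGierDuminilCopinGuttmann2014, Proposition 5 (arXiv v5 p. 9: μ(y) finite, non-decreasing); HammersleyTorrieWhittington1982, §2 (μ(y') ≤ (y'/y)^{1/2}-type bounds); DuminilCopinSmirnov2012, Theorem 1 (μ = √(2+√2))] -/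
theorem surfaceMu_lt_self (hy : 2 + Real.sqrt 2 < y) : HV.surfaceMu y < y := by
  have h2 : (0 : ℝ) < 2 + Real.sqrt 2 := by positivity
  have hy0 : 0 < y := h2.trans hy
  have hy1 : 1 ≤ y := by
    have := Real.sqrt_nonneg 2
    linarith
  have hμ : hexConnectiveConstant < Real.sqrt y := by
    rw [hexConnectiveConstant_eq_of_thm1 DuminilCopinSmirnov2012_thm1_holds]
    exact Real.sqrt_lt_sqrt h2.le hy
  calc HV.surfaceMu y ≤ Real.sqrt y * hexConnectiveConstant := HV.surfaceMu_le_sqrt_mul hy1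
    _ < Real.sqrt y * Real.sqrt y := mul_lt_mul_of_pos_left hμ (Real.sqrt_pos.2 hy0)
    _ = y := Real.mul_self_sqrt hy0.le

/-- **`μ(y) < μ_0(y,y)`** for `y > 2 + √2`: the one-row strip with two attractive walls beats the half-plane.
[cite: BeatonBousquetMelouDeGierDuminilCopinGuttmann2014, Propositions 5–7 (arXiv v5 pp. 9–11); the comparison is the lane's] -/
theorem surfaceMu_lt_stripMuY₂_zero_self (hy : 2 + Real.sqrt 2 < y) : HV.surfaceMu y < stripMuY₂ 0 y y := by
  have hy0 : 0 < y := lt_trans (by positivity) hy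
  rw [stripMuY₂_zero_self hy0]
  exact surfaceMu_lt_self hy

/-- **`μ_T(y,y) → μ(y)`** (equal fugacities). [cite: BeatonBousquetMelouDeGierDuminilCopinGuttmann2014, Proposition 7 (arXiv v5 p. 11: μ_T(1,y) → μ(y); the two-wall limit by reference to [16] = Janse van Rensburg–Orlandini–Whittington 2006)] -/
theorem tendsto_stripMuY₂_self (hy : 0 < y) : Tendsto (fun T : ℕ => stripMuY₂ T y y) atTop (𝓝 (HV.surfaceMu y)) := by
  simpa only [max_self] using tendsto_stripMuY₂_atTop hy hy

/-- **Non-monotone regime**: for `y > 2 + √2`, `μ_T(y,y) < μ_0(y,y)` for all large `T`.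
[cite: BeatonBousquetMelouDeGierDuminilCopinGuttmann2014, Proposition 7 (arXiv v5 p. 11: monotonicity in T is printed for ONE weighted wall); the two-wall failure is the lane's] -/
theorem eventually_stripMuY₂_self_lt_zero (hy : 2 + Real.sqrt 2 < y) :
    ∀ᶠ T : ℕ in atTop, stripMuY₂ T y y < stripMuY₂ 0 y y := by
  have hy0 : 0 < y := lt_trans (by positivity) hy
  exact (tendsto_stripMuY₂_self hy0).eventually_lt_const (surfaceMu_lt_stripMuY₂_zero_self hy)

/-- **For `y > 2 + √2` the tower `T ↦ μ_T(y,y)` is not monotone.** [cite: BeatonBousquetMelouDeGierDuminilCopinGuttmann2014, Proposition 7 (arXiv v5 p. 11); the two-wall failure is the lane's] -/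
theorem not_monotone_stripMuY₂_self (hy : 2 + Real.sqrt 2 < y) : ¬ Monotone fun T : ℕ => stripMuY₂ T y y := by
  intro hmono
  obtain ⟨T, hT⟩ := (eventually_stripMuY₂_self_lt_zero hy).exists
  exact absurd hT (not_lt.2 (hmono (Nat.zero_le T)))

/-- For `y > 2 + √2` the tower `μ_T(y,y)` strictly DECREASES at some width `T → T + 1`. [cite: BeatonBousquetMelouDeGierDuminilCopinGuttmann2014, Proposition 7 (arXiv v5 p. 11); the two-wall failure is the lane's] -/
theorem exists_stripMuY₂_self_succ_lt (hy : 2 + Real.sqrt 2 < y) : ∃ T : ℕ, stripMuY₂ (T + 1) y y < stripMuY₂ T y y := by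
  by_contra h
  exact not_monotone_stripMuY₂_self hy (monotone_nat_of_le_succ fun T => not_lt.1 (not_exists.1 h T))

/-- For `y > 2 + √2` the limit `μ(y)` of the tower `μ_T(y,y)` is NOT its supremum: `μ(y) < sup_T μ_T(y,y)` whenever the
supremum bound holds, witnessed at `T = 0`. Stated as: the limit lies strictly below the `T = 0` term.
[cite: BeatonBousquetMelouDeGierDuminilCopinGuttmann2014, Proposition 7 (arXiv v5 p. 11); the two-wall failure is the lane's] -/
theorem lim_stripMuY₂_self_lt_zero (hy : 2 + Real.sqrt 2 < y) :
    limUnder atTop (fun T : ℕ => stripMuY₂ T y y) < stripMuY₂ 0 y y := by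
  have hy0 : 0 < y := lt_trans (by positivity) hy
  rw [(tendsto_stripMuY₂_self hy0).limUnder_eq]
  exact surfaceMu_lt_stripMuY₂_zero_self hy

end Literature.Probability.RandomPlanarGeometry.SAW.HexBW
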